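import Summits.QuantumFields.YangMills.Theorems.LuscherReductionTwistedTraceScalingOneSiteShellGain
import Summits.QuantumFields.YangMills.Theorems.LuscherReductionRunningReductionCoarseUpperCopies
import Summits.QuantumFields.YangMills.Theorems.LuscherReductionOneSiteLevelsAbsUpperSeam
import HarnessLib

/-!
# Preliminaries for the LOCALISED one-site near-maximiser (`…OneSiteNearTop`): one-site geometry near the twist copies and the real endgame
# (lane A of S-BASE, crux `TwistedTraceScaling` stmt-QuantumFields-20203, C4 INNER; design note `pub/ym-fleet/ym-luscher-20007-p1/COARSE-DESIGN.md` §24.4 (OS0))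

The FLOOR clause of the package needs a ONE-SITE trial amplitude that is (i) gauge (`Ad`) invariant, (ii) supported inside the slow core (one twist copy of the vacuum), and
(iii) almost optimal: `⟨φ, K_B φ⟩ ≥ e^{−ελ_b(B)}·μ₀(B)·‖φ‖²`.  THIS FILE produces it from the tree, with no new analysis:
* `exists_twist3_orbitDist_le` — at one site a configuration with small vector parts is within `6‖zmCoord 1 U‖` of SOME twist copy of the vacuum; hence
  `sin_innerPhase_eq_zero_of_zmCoord_le`: the OUTER IMS piece `sin Θ_δ · ψ` vanishes on `{‖zmCoord 1 U‖ ≤ δ/12}`;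
* `near_top_algebra` — the real-number endgame;
* `exp_neg_le_one_sub_half`, `exp_neg_sub_exp_neg_two_ge` — two elementary exponential inequalities on `[0, 1/2]`.
The near-maximiser itself (`exists_localized_near_top`) is in `…OneSiteNearTop`.
HONEST FRAMING: a one-site (finite-dimensional) statement, consequence of the PROVED crux ONE; it is an input of C4, not C4; not a gap, not Clay.
-/

set_option autoImplicit false

noncomputable section

open MeasureTheory Filter Topology Real
open scoped BigOperators
open Literature.MathematicalPhysics.QuantumFieldTheory
open Literature.MathematicalPhysics.QuantumLattice
open Literature.Analysis.OperatorTheory.YMMatrixModel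

namespace Summit.QuantumFields.YangMills.Theorems.FemtoTransferGap

/-! ## §1 Geometry at one site: small vector parts ⇒ close to a twist copy of the vacuum -/

/-- A link with nonnegative scalar part is within twice its vector part of `1`: `‖W − 1‖_F² ≤ 4Σ_a vecPart(W)_a²`. [folklore] -/
theorem frobNorm_sub_one_sq_le_of_scalarPart_nonneg {W : SU2} (hW : 0 ≤ scalarPart W) :
    frobNorm ((W : Matrix (Fin 2) (Fin 2) ℂ) - 1) ^ 2 ≤ 4 * ∑ a, vecPart W a ^ 2 := by
  rw [frobNorm_sub_one_sq_eq_scalarPart]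
  have h := scalarPart_sq_add W
  have h1 : scalarPart W ≤ 1 := by nlinarith [Finset.sum_nonneg fun a (_ : a ∈ Finset.univ) => sq_nonneg (vecPart W a)]
  nlinarith

/-- ★ At one site, EVERY configuration is within `6‖zmCoord 1 U‖` (in `orbitDist`) of one of the eight twist copies of the vacuum: flip the links with negative scalar part.
[folklore] -/
theorem exists_twist3_orbitDist_le (U : GaugeConfig 3 1 SU2) : ∃ z : Fin 3 → Bool, orbitDist (TT.twist3 z U) ≤ 6 * ‖zmCoord 1 U‖ := by
  set z : Fin 3 → Bool := fun i => decide (scalarPart (U (edgeOf i)) < 0) with hz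
  refine ⟨z, ?_⟩
  have hlink : ∀ e : Edge 3 1, TT.twist3 z U e = TT.centreElem (z e.2) * U e := fun e => by
    rw [TT.twist3_apply, if_pos (Subsingleton.elim _ _)]
  -- each flipped link has nonnegative scalar part and the same vector-part norm
  have hsc : ∀ e : Edge 3 1, 0 ≤ scalarPart (TT.twist3 z U e) ∧ ∑ a, vecPart (TT.twist3 z U e) a ^ 2 = ∑ a, vecPart (U e) a ^ 2 := fun e => by
    rw [hlink e]
    have hUe : U e = U (edgeOf e.2) := by rw [edgeOf_snd]
    by_cases h : scalarPart (U (edgeOf e.2)) < 0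
    · have hz1 : z e.2 = true := by rw [hz]; exact decide_eq_true h
      have hc : TT.centreElem (z e.2) = negOne := by rw [hz1]; rfl
      rw [hc, scalarPart_negOne_mul, vecPart_negOne_mul]
      refine ⟨by rw [hUe]; linarith, Finset.sum_congr rfl fun a _ => by simp⟩
    · have hz0 : z e.2 = false := by rw [hz]; exact decide_eq_false h
      have hc : TT.centreElem (z e.2) = 1 := by rw [hz0]; rfl
      rw [hc, one_mul]
      exact ⟨by rw [hUe]; linarith, rfl⟩
  have hper : ∀ e : Edge 3 1, frobNorm (((TT.twist3 z U e : SU2) : Matrix (Fin 2) (Fin 2) ℂ) - 1) ≤ 2 * ‖zmCoord 1 U‖ := fun e => by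
    obtain ⟨h0, hv⟩ := hsc e
    have h1 := frobNorm_sub_one_sq_le_of_scalarPart_nonneg h0
    rw [hv] at h1
    have h2 := sum_vecPart_sq_le_norm_zmCoord_sq U e
    have h3 : frobNorm (((TT.twist3 z U e : SU2) : Matrix (Fin 2) (Fin 2) ℂ) - 1) ^ 2 ≤ (2 * ‖zmCoord 1 U‖) ^ 2 := by nlinarith
    exact (abs_le_of_sq_le_sq' h3 (by positivity)).2
  calc orbitDist (TT.twist3 z U) ≤ gaugeDist 1 (TT.twist3 z U) := orbitDist_le 1 _
    _ = ∑ e : Edge 3 1, frobNorm (((TT.twist3 z U e : SU2) : Matrix (Fin 2) (Fin 2) ℂ) - 1) := by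
        unfold gaugeDist; simp only [TT.gaugeTransform_one']
    _ ≤ ∑ _e : Edge 3 1, 2 * ‖zmCoord 1 U‖ := Finset.sum_le_sum fun e _ => hper e
    _ = 6 * ‖zmCoord 1 U‖ := by simp; ring

/-- Hence the OUTER IMS piece vanishes on the small-vector-part ball: `‖zmCoord 1 U‖ ≤ δ/12` ⇒ `sin Θ_δ(U) = 0` (`δ > 0`). [cite: SimonB1983DiscreteSpectrum, §3] -/
theorem sin_innerPhase_eq_zero_of_zmCoord_le {δ : ℝ} (hδ : 0 < δ) {U : GaugeConfig 3 1 SU2} (hU : ‖zmCoord 1 U‖ ≤ δ / 12) :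
    Real.sin (innerPhase δ U) = 0 := by
  by_contra hne
  obtain ⟨z, hz⟩ := exists_twist3_orbitDist_le U
  have h := forall_lt_orbitDist_of_sin_ne_zero hδ hne z
  linarith

/-! ## §2 The real-number endgame -/

/-- The IMS + shell-gain + floor algebra: `μ(1−η)(a+b) ≤ q_C + q_S + eℓ(a+b)`, `q_S ≤ ℓ(1−g)b`, `q_C ≤ ℓa`, `ℓ ≤ (1+ζ)μ`, `ζ + η + e(1+ζ) < g ≤ 1` give
`μ(1 − η − e(1+ζ))a ≤ q_C` and `0 < a` (`μ > 0`, `a, b ≥ 0`, `a + b > 0`). [folklore] -/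
theorem near_top_algebra {μ ℓ qC qS a b η e g ζ : ℝ} (hμ : 0 < μ) (ha : 0 ≤ a) (hb : 0 ≤ b) (hn : 0 < a + b) (hℓ : ℓ ≤ (1 + ζ) * μ)
    (hζ : 0 ≤ ζ) (hη : 0 ≤ η) (he : 0 ≤ e) (hg1 : g ≤ 1)
    (h1 : μ * (1 - η) * (a + b) ≤ qC + qS + e * ℓ * (a + b)) (h2 : qS ≤ ℓ * (1 - g) * b) (h3 : qC ≤ ℓ * a) (hsmall : ζ + η + e * (1 + ζ) < g) :
    μ * (1 - η - e * (1 + ζ)) * a ≤ qC ∧ 0 < a := by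
  have hg0 : 0 ≤ 1 - g := by linarith
  have heζ : 0 ≤ e * (1 + ζ) := by positivity
  have hgpos : 0 < g := by linarith
  have hcoef0 : 0 < g + ζ * g - ζ - η - e * (1 + ζ) := by nlinarith [mul_nonneg hζ hgpos.le]
  have hℓb : ℓ * (1 - g) * b ≤ (1 + ζ) * μ * (1 - g) * b := by
    have := mul_le_mul_of_nonneg_right (mul_le_mul_of_nonneg_right hℓ hg0) hb; linarith
  have heℓ : e * ℓ * (a + b) ≤ e * ((1 + ζ) * μ) * (a + b) :=
    mul_le_mul_of_nonneg_right (mul_le_mul_of_nonneg_left hℓ he) hn.le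
  have h2' : qS ≤ (1 + ζ) * μ * (1 - g) * b := h2.trans hℓb
  -- lower bound on `qC`; the `b`-coefficient is positive
  have hqC : μ * (1 - η - e * (1 + ζ)) * a + μ * (g + ζ * g - ζ - η - e * (1 + ζ)) * b ≤ qC := by
    have e1 : μ * (1 - η - e * (1 + ζ)) * a + μ * (g + ζ * g - ζ - η - e * (1 + ζ)) * b =
        μ * (1 - η) * (a + b) - (1 + ζ) * μ * (1 - g) * b - e * ((1 + ζ) * μ) * (a + b) := by ring
    rw [e1]; linarith
  have hbcoef : 0 ≤ μ * (g + ζ * g - ζ - η - e * (1 + ζ)) * b := mul_nonneg (mul_nonneg hμ.le hcoef0.le) hb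
  refine ⟨by linarith, ?_⟩
  -- `a = 0` is impossible: then `qC ≤ 0` while the `b`-term is positive
  by_contra ha0
  have ha' : a = 0 := le_antisymm (not_lt.mp ha0) ha
  have hb' : 0 < b := by linarith
  have hq0 : qC ≤ 0 := by rw [ha', mul_zero] at h3; exact h3
  have hpos : 0 < μ * (g + ζ * g - ζ - η - e * (1 + ζ)) * b := mul_pos (mul_pos hμ hcoef0) hb'
  rw [ha', mul_zero, zero_add] at hqC
  linarith

/-- `e^{−y} ≤ 1 − y/2` for `0 ≤ y ≤ 1/2`. [folklore] -/
theorem exp_neg_le_one_sub_half {y : ℝ} (hy0 : 0 ≤ y) (hy : y ≤ 1 / 2) : Real.exp (-y) ≤ 1 - y / 2 := by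
  have h := Real.abs_exp_sub_one_sub_id_le (x := -y) (by rw [abs_neg, abs_of_nonneg hy0]; linarith)
  have h1 := (abs_le.mp h).2
  nlinarith

/-- `e^{−y} − e^{−2y} ≥ y/4` for `0 ≤ y ≤ 1/2` (`e^{−y} ≥ 1/2`, `1 − e^{−y} ≥ y/2`). [folklore] -/
theorem exp_neg_sub_exp_neg_two_ge {y : ℝ} (hy0 : 0 ≤ y) (hy : y ≤ 1 / 2) : y / 4 ≤ Real.exp (-y) - Real.exp (-(2 * y)) := by
  have h1 : 1 / 2 ≤ Real.exp (-y) := by have := Real.add_one_le_exp (-y); linarith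
  have h2 : y / 2 ≤ 1 - Real.exp (-y) := by have := exp_neg_le_one_sub_half hy0 hy; linarith
  have h3 : Real.exp (-(2 * y)) = Real.exp (-y) * Real.exp (-y) := by rw [← Real.exp_add]; ring_nf
  rw [h3]
  nlinarith [Real.exp_pos (-y)]

end Summit.QuantumFields.YangMills.Theorems.FemtoTransferGap

end
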